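import Summits.Ventures.HodgeRepro2.Tier7.Target
import Summits.Ventures.HodgeRepro2.Tier7.Lit3

/-!
# Tier7/Lit3Dict — the dictionary from the frozen datum to the Castelnuovo–de Franchis shape (t7-lit-3, for t7-L1-p4)

Cell pub-hodge-repro2, Tier 7. Asked by t7-L1-p4 (STATUS l. 14662 (3)): «the dictionary frozen datum →
`Beauville1996Shape` (Omega1 := H10, wedge := the product) so that `Hyp.Beauville1996_X_9` is CONSUMED BY NAME rather
than re-displayed». Definitions + proved lemmas only (no new Prop-valued display; no proof of a published theorem).

THE DICTIONARY. For a surface shadow `S : SurfaceShadow HX G` (the frozen `Tier7/Target.lean`, sha256 6e511b88…):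
`Omega1 := S.H10` (the holomorphic 1-forms, as a ℂ-module), `Omega2 := HX` (the cup product of two 1-forms lands in
`H10 * H10 ⊂ HX`; the shape only needs a ℂ-module receiving the wedge), `wedge := the ring product of HX restricted to
H10` (ℂ-bilinear since `HX` is a ℂ-algebra — `LinearMap.mul ℂ HX` composed with the inclusion of `H10`). The CURVES,
the connected-fibre surjections, their 1-forms and the pull-backs are NOT in the datum (the shadow carries no
curves), so they are PARAMETERS of the dictionary: a `CurveData S` = (Curve, genus, Fibration, OmegaB, pull) with
`pull` landing in `H10`. `Hyp.Beauville1996_X_9 (S.beauvilleShape C)` is then the printed Proposition X.9 read on the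
real surface's `H^{1,0}` with its real curves — a LEMMA hypothesis of Line 1 (never of `P_T7`).

THE CONTRAPOSITIVE the line consumes (`wedge_ne_zero_of_X_9`): two linearly independent holomorphic 1-forms that are
not both pulled back from one connected-fibre surjection to a curve of genus ≥ 2 have a non-zero wedge.

Non-vacuity: `CurveData` is inhabited for every `S` (the empty family of curves — `Curve := Empty`), and for it
`Beauville1996_X_9 (S.beauvilleShape C)` says exactly «independent 1-forms have non-zero wedge» (no curve to pull back
from): that is the statement p4's `WedgeNonzero` needs, and on the datum of record it is FALSE (H10 = N with N² = 0) —
so, as it must, the display fails in the junk datum and is a genuine hypothesis about the real X (two-sided test: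
recorded here, not decided here).

§8(d): uses an L-value-free non-vanishing device: NO.
-/

namespace Summit.Ventures.HodgeRepro2.Tier7

noncomputable section

variable {HX : Type} [Ring HX] [Algebra ℂ HX] {G : Type} [Group G] [MulAction G HX]

/-- the curves of the real surface, as parameters of the dictionary: the smooth projective curves `B`, their genus,
the surjective morphisms `X → B` with connected fibres, `H⁰(B, Ω¹_B)` and the pull-back `p^*` into `H^{1,0}(X)` -/
structure CurveData (S : SurfaceShadow HX G) where
  /-- the smooth curves `B` -/
  Curve : Type
  /-- the genus of `B` -/
  genus : Curve → ℕ
  /-- the surjective morphisms `p : X → B` with connected fibres -/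
  Fibration : Curve → Type
  /-- `H⁰(B, Ω¹_B)` -/
  OmegaB : Curve → Type
  [instAddOmegaB : ∀ B, AddCommGroup (OmegaB B)]
  [instModOmegaB : ∀ B, Module ℂ (OmegaB B)]
  /-- `p^* : H⁰(B, Ω¹_B) → H^{1,0}(X)` -/
  pull : ∀ B, Fibration B → (OmegaB B →ₗ[ℂ] S.H10)

namespace CurveData

variable {S : SurfaceShadow HX G} (C : CurveData S)

/-- the additive structure of `H⁰(B, Ω¹_B)` (field) -/
instance (B : C.Curve) : AddCommGroup (C.OmegaB B) := C.instAddOmegaB B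
/-- the ℂ-vector space structure of `H⁰(B, Ω¹_B)` (field) -/
instance (B : C.Curve) : Module ℂ (C.OmegaB B) := C.instModOmegaB B

end CurveData

namespace SurfaceShadow

variable (S : SurfaceShadow HX G)

/-- the wedge of two holomorphic 1-forms = the ring product of `HX` restricted to `H10`, as a ℂ-bilinear map -/
def wedge10 : S.H10 →ₗ[ℂ] S.H10 →ₗ[ℂ] HX :=
  (LinearMap.mul ℂ HX).compl₁₂ S.H10.subtype S.H10.subtype

/-- `wedge10` is the ring product of `HX` on the underlying elements (by definition) -/
@[simp] theorem wedge10_apply (a b : S.H10) : S.wedge10 a b = (a : HX) * b := rfl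

/-- THE DICTIONARY: the Castelnuovo–de Franchis shape of the surface `X` behind `S`, with the curves `C`. -/
def beauvilleShape (C : CurveData S) : Beauville1996Shape where
  Omega1 := S.H10
  Omega2 := HX
  wedge := S.wedge10
  Curve := C.Curve
  genus := C.genus
  Fibration := C.Fibration
  OmegaB := C.OmegaB
  pull := C.pull

/-- the empty family of curves (no pencil at all) — inhabits `CurveData S` for every shadow -/
def noCurves : CurveData S where
  Curve := Empty
  genus := fun B => B.elim
  Fibration := fun B => B.elim
  OmegaB := fun B => B.elim
  instAddOmegaB := fun B => B.elim
  instModOmegaB := fun B => B.elim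
  pull := fun B => B.elim

/-- Proposition X.9 read through the dictionary, contrapositive: two linearly independent holomorphic 1-forms on
`X` that are not both pulled back from one connected-fibre surjection `X → B` with `g(B) ≥ 2` have a non-zero wedge
(= cup product in `H^*(X_∞, ℂ)`). -/
theorem wedge_ne_zero_of_X_9 (C : CurveData S) (h : Hyp.Beauville1996_X_9 (S.beauvilleShape C))
    (ω₁ ω₂ : S.H10) (hli : LinearIndependent ℂ ![ω₁, ω₂])
    (hno : ∀ B : C.Curve, 2 ≤ C.genus B → ∀ (p : C.Fibration B) (α₁ α₂ : C.OmegaB B),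
      ¬ (ω₁ = C.pull B p α₁ ∧ ω₂ = C.pull B p α₂)) :
    (ω₁ : HX) * ω₂ ≠ 0 := by
  intro hzero
  obtain ⟨B, hB, p, α₁, α₂, h₁, h₂⟩ := h ω₁ ω₂ hli hzero
  exact hno B hB p α₁ α₂ ⟨h₁, h₂⟩

/-- with no curves at all, Proposition X.9 says: independent holomorphic 1-forms have a non-zero wedge -/
theorem wedge_ne_zero_of_X_9_noCurves (h : Hyp.Beauville1996_X_9 (S.beauvilleShape S.noCurves))
    (ω₁ ω₂ : S.H10) (hli : LinearIndependent ℂ ![ω₁, ω₂]) : (ω₁ : HX) * ω₂ ≠ 0 :=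
  S.wedge_ne_zero_of_X_9 S.noCurves h ω₁ ω₂ hli (fun B => B.elim)

end SurfaceShadow

end

end Summit.Ventures.HodgeRepro2.Tier7
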